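import Summits.BirchSwinnertonDyer.BirchSwinnertonDyer.Statement
import Literature.NumberTheory.EllipticCurves.Zywina2025Torsion
import Literature.NumberTheory.EllipticCurves.SelmerCorankHolds
import Literature.NumberTheory.EllipticCurves.LeadingTerm
import Literature.NumberTheory.EllipticCurves.KatoRankBound
import Literature.NumberTheory.EllipticCurves.AnalyticRankWindow
import Literature.NumberTheory.EllipticCurves.AnalyticRankOrderProofs
import Literature.NumberTheory.EllipticCurves.AnalyticRankModularityProofs
import Literature.NumberTheory.EllipticCurves.RootNumberEvenAnalyticRankProofs
import Literature.NumberTheory.EllipticCurves.PAdicLFunctionOrderParityProofs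
import Literature.NumberTheory.EllipticCurves.PAdicLFunctionNeZeroProofs
import HarnessLib

/-!
# THE BSD-RANK DOOR ON ZYWINA'S RANK-2 FAMILY — (E1) is a tree theorem, the equality input is (E2) alone
# (route `ShaPrimaryTransfer`, crux `FiniteShaComponentTransfer` = stmt-BirchSwinnertonDyer-22356: helper; cell bsd-rank2, planner p2 GEN 55 kernel `ZYWINA-CLASS-DOOR`)

Zywina's family `E_{m,n} : y² = x³ − 5(m+16n²)x² + 4(m+16n²)(m+25n²)x` (`m`, `m+16n²`, `m+25n²` primes `≡ 11 (mod 24)`,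
`n > 0`; D. Zywina, arXiv:2502.01957, Thm. 1.2) is the one infinite class (modulo `zywinaSet_infinite`, i.e. Tao–Ziegler)
on which the Mordell–Weil side of barrier B1 is ALREADY A THEOREM OF THE TREE: `rank E_{m,n}(ℚ) = 2`,
`Ш(E_{m,n})[2^∞] = 0`, `corank_{ℤ₂} Sel_{2^∞} = 2` (`Zywina2025.mordellWeilRank_zywinaCurve`, `…shaCorank_two_zywinaCurve`,
`…selmerCorank_two_zywinaCurve`; no named fact).  This file reads that at the level of the SUMMIT PREDICATE
`ord_{s=1} L(E,s) = rank E(ℚ)` (the conjunct of `Literature.BSDRankConjecture` at `E_{m,n}`), in the style of the silent-class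
door `Rank2/SilentClassBSDRank.lean` (p2 GEN 50) but with FEWER displayed inputs — no Kato, no `2`-adic anchor datum:

* §1 `zywina_core`, `zywina_bsdRank_iff_analyticRank_le_two` (GZK only): `rank = 2 ≤ r_an`, `L(E,1) = L′(E,1) = 0`, and
  **`r_an(E_{m,n}) = rank E_{m,n}(ℚ) ⟺ r_an ≤ 2 ⟺ r_an = 2`**;  `zywina_bsdRank_iff_secondDeriv_ne_zero` (GZK + modularity):
  **`r_an = rank ⟺ L″(E_{m,n},1) ≠ 0`** — the extra input is barrier B1's (E2) ALONE, (E1) being Zywina's theorem;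
  `zywina_window` (+ `2`-parity): `w = +1`, `r_an ∈ {2} ∪ {4, 6, …}`, so `r_an = rank ⟺ ¬ 4 ≤ r_an`.
* §2 class forms: `zywinaClass_bsdRank_iff` — **(BSD-rank for every admissible `E_{m,n}`) ⟺ (`L″(E_{m,n},1) ≠ 0` for every
  admissible `(m,n)`)**; `analyticRank_eq_two_zywinaCurve_of_bsd` — the SUMMIT implies `r_an(E_{m,n}) = 2` EXACTLY
  (`L = L′ = 0 ≠ L″` at `s = 1`) for every admissible pair, hence (`infinite_setOf_j_analyticRank_two_of_bsd`, modulo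
  `zywinaSet_infinite`) infinitely many `j`-invariants of analytic rank exactly `2` — a consequence of the summit that is itself
  OPEN in print (ladder row B1: «infinitely many `E` with `r_an = 2` exactly» open; Zywina gives MW rank `2` only); conversely
  `infinite_setOf_j_bsdRank_two_of_secondDeriv` — family-wise (E2) gives BSD-rank on infinitely many `j` of rank `2`.
* §3 the ODD-PRIME `p`-ADIC READING (the seat's purpose on this class), `zywina_padicWindow`: at every odd good ordinary `q` of
  `E_{m,n}` with newform `f`, granting Kato's Thm. 18.4 at `q`: `2 = rank ≤ corank_{ℤ_q} Sel_{q^∞} = 2 + t_q ≤ ord_{T=0} L_q(E_{m,n},T)`,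
  and `ord_{T=0} L_q ≡ r_an ≡ 0 (mod 2)` by the PROVED parity transfer (`even_order_padicLFunction_iff_even_analyticRank`) and
  `2`-parity; `ord_{T=0} L_q = 2 ⟹ t_q = 0` (cross-prime row) but NOT `r_an = 2`: the residual cell `r_an ≥ 4`, `ord_T L_q = 2 =
  corank` is excluded by no theorem in print (`Literature.NumberTheory.EllipticCurves.four_le_order_padicLFunction_or_residual`, file `PAdicLFunctionOrderTransferProofs`).  So on this class the
  `q`-adic analytic order and the complex analytic order need INDEPENDENT caps — `[T²]L_q ≠ 0` for `Ш[q^∞]`, (E2) for BSD-rank.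
Displayed hypotheses: PRINT `hGZK` (Gross–Zagier–Kolyvagin, `rank_eq_analyticRank_of_analyticRank_le_one`), `hmod` (modularity,
`exists_isNewformOf`), `hpar` (`2`-parity, Dokchitser–Dokchitser), `hK` (Kato Thm. 18.4 at `q`), `hZ` (`zywinaSet_infinite`).
HONEST FRAMING (B1): EQUIVALENCES, windows and consequences of the summit only; **BSD is NOT proved for any `E_{m,n}`**; no value of
`L″(E_{m,n},1)` is certified here (for `E_{659,12}` it is a numerical statement, not claimed).
Helper file `--supports stmt-22356 --as helper` (companion of `…FiniteShaComponentTransferRankTwoDoor` §5 and `…CrossPrimeRow`, whose explicit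
member `E_{659,12}` = `zywinaAdmissible_659_12` instantiates every statement below): it sharpens RankTwoDoor §5 — BSD-rank on the family needs only
`r_an ≤ 2` (there derived from T ∧ X2) — and reads the cross-prime row against the summit predicate.  ROUTE-INDEPENDENT imports (Literature +
the Statement only; theses-cone lint).  Nothing here proves T, X2, O class-wide or BSD.
Refs: D. Zywina, arXiv:2502.01957 (2025) Thm. 1.2; V. Kolyvagin (1990) Thm. A; Breuil–Conrad–Diamond–Taylor, JAMS 14 (2001) Thm. A;
T. & V. Dokchitser, Ann. Math. 172 (2010) Thm. 1.4; K. Kato, Astérisque 295 (2004) Thm. 18.4; J. Cremona, *Algorithms* (1997) §2.13;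
Mazur–Tate–Teitelbaum, Invent. Math. 84 (1986) §II.10.
-/

-- D-0017: single-problem summit, so `Summit.BirchSwinnertonDyer.BirchSwinnertonDyer.…` repeats a namespace BY DESIGN.
set_option linter.dupNamespace false
set_option autoImplicit false

noncomputable section

open scoped Classical MatrixGroups ModularForm

open CongruenceSubgroup WeierstrassCurve
  Literature.NumberTheory.EllipticCurves
  Literature.NumberTheory.EllipticCurves.ModularForms
  Literature.NumberTheory.EllipticCurves.Zywina2025

namespace Summit.BirchSwinnertonDyer.BirchSwinnertonDyer.Theorems.ShaPrimaryTransferZywinaBSDRankDoor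

/-! ### §1. The door per member `E_{m,n}` -/

section Member

variable {m n : ℕ}

/-- `2 ≤ ord_{s=1} L(E_{m,n},s)` from Gross–Zagier–Kolyvagin (`r_an ≤ 1` would force `rank ≤ 1`, against Zywina's `rank = 2`);
same content as `…FiniteShaComponentTransferRankTwoDoor.two_le_analyticRank_zywinaCurve_of_GZK`, re-derived to keep this file
route-independent. [cite: Kolyvagin1990, Thm. A] [cite: Zywina2025, Thm 1.2] -/
private theorem two_le_analyticRank_of_GZK (hGZK : rank_eq_analyticRank_of_analyticRank_le_one)
    (h : ZywinaAdmissible m n) : 2 ≤ (zywinaCurve m n).analyticRank := by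
  haveI := isElliptic_zywinaCurve h
  by_contra hlt
  have hr := (hGZK (zywinaCurve m n) (by omega)).1
  have h2 := mordellWeilRank_zywinaCurve h
  omega

/-- **Core of the Zywina-class door.**  For admissible `(m, n)`: `rank E_{m,n}(ℚ) = 2` and `corank_{ℤ₂} Sel_{2^∞} = 2`,
`t_2 = 0` (Zywina's descent, TREE THEOREMS), `2 ≤ r_an(E_{m,n})` (Gross–Zagier–Kolyvagin contrapositive), hence
`L(E_{m,n},1) = 0` and `L′(E_{m,n},1) = 0` (`L` entire by modularity).  B1: no upper bound on `r_an`; BSD not proved.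
[cite: Zywina2025, Thm 1.2] [cite: Kolyvagin1990, Thm. A] [cite: CremonaAlgorithms1997, §2.13 p. 37] -/
theorem zywina_core (hmod : exists_isNewformOf) (hGZK : rank_eq_analyticRank_of_analyticRank_le_one)
    (h : ZywinaAdmissible m n) :
    (zywinaCurve m n).mordellWeilRank = 2 ∧ (zywinaCurve m n).selmerCorank 2 = 2 ∧
      (zywinaCurve m n).shaCorank 2 = 0 ∧ 2 ≤ (zywinaCurve m n).analyticRank ∧
      (zywinaCurve m n).entireLFunction 1 = 0 ∧ iteratedDeriv 1 (zywinaCurve m n).entireLFunction 1 = 0 := by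
  haveI := isElliptic_zywinaCurve h
  have hL : (zywinaCurve m n).HasEntireLFunction :=
    hasEntireLFunction_rat_of_exists_isNewformOf hmod (zywinaCurve m n)
  have h2 : 2 ≤ (zywinaCurve m n).analyticRank := two_le_analyticRank_of_GZK hGZK h
  refine ⟨mordellWeilRank_zywinaCurve h, selmerCorank_two_zywinaCurve h, shaCorank_two_zywinaCurve h, h2, ?_, ?_⟩
  · have h0 := iteratedDeriv_entireLFunction_one_eq_zero (zywinaCurve m n) hL (k := 0) (by omega)
    simpa using h0
  · exact iteratedDeriv_entireLFunction_one_eq_zero (zywinaCurve m n) hL (k := 1) (by omega)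

/-- **THE DOOR, GZK-only form**: for admissible `(m, n)`, **`ord_{s=1} L(E_{m,n},s) = rank E_{m,n}(ℚ) ⟺ ord_{s=1} L(E_{m,n},s) ≤ 2`**
(`rank = 2` is Zywina's theorem, `2 ≤ r_an` is GZK).  The whole of BSD-rank for the member is an analytic-rank UPPER BOUND — barrier
B1's (E2); its (E1) is discharged by the tree.  B1: an EQUIVALENCE; BSD not proved. [cite: Zywina2025, Thm 1.2] [cite: Kolyvagin1990, Thm. A] -/
theorem zywina_bsdRank_iff_analyticRank_le_two (hGZK : rank_eq_analyticRank_of_analyticRank_le_one)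
    (h : ZywinaAdmissible m n) :
    (zywinaCurve m n).analyticRank = (zywinaCurve m n).mordellWeilRank ↔ (zywinaCurve m n).analyticRank ≤ 2 := by
  have h2 : 2 ≤ (zywinaCurve m n).analyticRank := two_le_analyticRank_of_GZK hGZK h
  have hr := mordellWeilRank_zywinaCurve h
  omega

/-- Same door, `= 2` form: **`r_an(E_{m,n}) = rank E_{m,n}(ℚ) ⟺ r_an(E_{m,n}) = 2`**. [cite: Zywina2025, Thm 1.2] [cite: Kolyvagin1990, Thm. A] -/
theorem zywina_bsdRank_iff_analyticRank_eq_two (hGZK : rank_eq_analyticRank_of_analyticRank_le_one)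
    (h : ZywinaAdmissible m n) :
    (zywinaCurve m n).analyticRank = (zywinaCurve m n).mordellWeilRank ↔ (zywinaCurve m n).analyticRank = 2 := by
  have h2 : 2 ≤ (zywinaCurve m n).analyticRank := two_le_analyticRank_of_GZK hGZK h
  have hr := mordellWeilRank_zywinaCurve h
  omega

/-- **THE DOOR, second-derivative form**: for admissible `(m, n)`, **`ord_{s=1} L(E_{m,n},s) = rank E_{m,n}(ℚ) ⟺ L″(E_{m,n},1) ≠ 0`**
(`→`: `r_an = rank = 2` and the leading derivative is non-zero; `←`: a non-zero second derivative caps `r_an ≤ 2`, GZK floors it at `2`).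
On this class the EXACT EXTRA INPUT for BSD-rank is (E2) `L″(E,1) ≠ 0` ALONE.  B1: an EQUIVALENCE; no `L″` value is certified; BSD
not proved. [cite: Zywina2025, Thm 1.2] [cite: CremonaAlgorithms1997, §2.13 p. 37] [cite: Kolyvagin1990, Thm. A] -/
theorem zywina_bsdRank_iff_secondDeriv_ne_zero (hmod : exists_isNewformOf)
    (hGZK : rank_eq_analyticRank_of_analyticRank_le_one) (h : ZywinaAdmissible m n) :
    (zywinaCurve m n).analyticRank = (zywinaCurve m n).mordellWeilRank ↔
      iteratedDeriv 2 (zywinaCurve m n).entireLFunction 1 ≠ 0 := by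
  haveI := isElliptic_zywinaCurve h
  have hL : (zywinaCurve m n).HasEntireLFunction :=
    hasEntireLFunction_rat_of_exists_isNewformOf hmod (zywinaCurve m n)
  have h2 : 2 ≤ (zywinaCurve m n).analyticRank := two_le_analyticRank_of_GZK hGZK h
  have hr := mordellWeilRank_zywinaCurve h
  constructor
  · intro heq
    have hra : (zywinaCurve m n).analyticRank = 2 := by omega
    have hlead := iteratedDeriv_analyticRank_ne_zero (zywinaCurve m n) hL
    rwa [hra] at hlead
  · intro hD
    have hup := analyticRank_le_of_iteratedDeriv_ne_zero (zywinaCurve m n) hL hD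
    omega

/-- **(E2) ⟹ BSD-rank at rank 2 for the member, with everything else a theorem**: `L″(E_{m,n},1) ≠ 0` gives `r_an = rank = 2`,
`L(E,1) = L′(E,1) = 0`, `corank Sel_{2^∞} = 2`, `Ш[2^∞] = 0`.  CONDITIONAL on the displayed `hD` (not certified here).
[cite: Zywina2025, Thm 1.2] [cite: CremonaAlgorithms1997, §2.13 p. 37] -/
theorem zywina_bsdRank_of_secondDeriv_ne_zero (hmod : exists_isNewformOf)
    (hGZK : rank_eq_analyticRank_of_analyticRank_le_one) (h : ZywinaAdmissible m n)
    (hD : iteratedDeriv 2 (zywinaCurve m n).entireLFunction 1 ≠ 0) :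
    (zywinaCurve m n).analyticRank = (zywinaCurve m n).mordellWeilRank ∧ (zywinaCurve m n).analyticRank = 2 ∧
      (zywinaCurve m n).mordellWeilRank = 2 ∧ (zywinaCurve m n).entireLFunction 1 = 0 ∧
      iteratedDeriv 1 (zywinaCurve m n).entireLFunction 1 = 0 ∧ (zywinaCurve m n).shaCorank 2 = 0 := by
  have heq := (zywina_bsdRank_iff_secondDeriv_ne_zero hmod hGZK h).mpr hD
  obtain ⟨hr, -, hsha, h2, hL0, hL1⟩ := zywina_core hmod hGZK h
  exact ⟨heq, by omega, hr, hL0, hL1, hsha⟩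

/-- **The window with `2`-parity**: granting the `2`-parity theorem (root-number form, `p_parity · 2`) and modularity, `w(E_{m,n}) = +1`,
`r_an(E_{m,n})` is EVEN and `≥ 2`, so `r_an ∈ {2} ∪ {4, 6, …}` and **`r_an = rank ⟺ ¬ 4 ≤ r_an`** — the first cell (E2) must exclude
is `r_an = 4`.  B1: not proved. [cite: DokchitserDokchitserAnnals2010, Thm. 1.4] [cite: Zywina2025, §1.1] -/
theorem zywina_window (hmod : exists_isNewformOf) (hGZK : rank_eq_analyticRank_of_analyticRank_le_one)
    (hpar : ∀ (V : WeierstrassCurve ℚ) [V.IsElliptic], p_parity V 2) (h : ZywinaAdmissible m n) :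
    (zywinaCurve m n).rootNumber = 1 ∧ Even (zywinaCurve m n).analyticRank ∧ 2 ≤ (zywinaCurve m n).analyticRank ∧
      ((zywinaCurve m n).analyticRank = (zywinaCurve m n).mordellWeilRank ↔ ¬ 4 ≤ (zywinaCurve m n).analyticRank) := by
  haveI := isElliptic_zywinaCurve h
  have hw : (zywinaCurve m n).rootNumber = 1 := rootNumber_zywinaCurve hpar h
  have heven : Even (zywinaCurve m n).analyticRank :=
    (even_analyticRank_iff_of_exists_isNewformOf hmod (zywinaCurve m n)).mpr hw
  have h2 : 2 ≤ (zywinaCurve m n).analyticRank := two_le_analyticRank_of_GZK hGZK h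
  have hr := mordellWeilRank_zywinaCurve h
  refine ⟨hw, heven, h2, ?_⟩
  obtain ⟨k, hk⟩ := heven
  omega

end Member

/-! ### §2. Class forms, and the summit's consequence on the class -/

section Class

/-- **THE CLASS DOOR**: BSD-rank holds for EVERY admissible `E_{m,n}` iff `L″(E_{m,n},1) ≠ 0` for EVERY admissible `(m, n)` —
on Zywina's family the summit predicate IS the family-wise second-derivative non-vanishing (modulo GZK and modularity).
B1: an EQUIVALENCE between two open statements; neither side is proved. [cite: Zywina2025, Thm 1.2] [cite: CremonaAlgorithms1997, §2.13 p. 37] -/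
theorem zywinaClass_bsdRank_iff (hmod : exists_isNewformOf) (hGZK : rank_eq_analyticRank_of_analyticRank_le_one) :
    (∀ m n : ℕ, ZywinaAdmissible m n → (zywinaCurve m n).analyticRank = (zywinaCurve m n).mordellWeilRank) ↔
      ∀ m n : ℕ, ZywinaAdmissible m n → iteratedDeriv 2 (zywinaCurve m n).entireLFunction 1 ≠ 0 :=
  ⟨fun H m n h => (zywina_bsdRank_iff_secondDeriv_ne_zero hmod hGZK h).mp (H m n h),
    fun H m n h => (zywina_bsdRank_iff_secondDeriv_ne_zero hmod hGZK h).mpr (H m n h)⟩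

/-- **The summit's consequence on the class** (a «weakest unknown consequence» shape): `BirchSwinnertonDyer` (BSD-rank for all `E/ℚ`)
implies that every admissible `E_{m,n}` has analytic rank EXACTLY `2`: `L(E_{m,n},1) = L′(E_{m,n},1) = 0 ≠ L″(E_{m,n},1)` (modulo
modularity for `L` entire; GZK is not needed in this direction).  The conclusion is OPEN in print for any infinite family.
[cite: Zywina2025, Thm 1.2 and §1 (r_an = 2 not claimed)] [cite: CremonaAlgorithms1997, §2.13 p. 37] -/
theorem analyticRank_eq_two_zywinaCurve_of_bsd (hmod : exists_isNewformOf) (hBSD : _root_.BirchSwinnertonDyer)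
    {m n : ℕ} (h : ZywinaAdmissible m n) :
    (zywinaCurve m n).analyticRank = 2 ∧ (zywinaCurve m n).entireLFunction 1 = 0 ∧
      iteratedDeriv 1 (zywinaCurve m n).entireLFunction 1 = 0 ∧ iteratedDeriv 2 (zywinaCurve m n).entireLFunction 1 ≠ 0 := by
  haveI := isElliptic_zywinaCurve h
  have hL : (zywinaCurve m n).HasEntireLFunction :=
    hasEntireLFunction_rat_of_exists_isNewformOf hmod (zywinaCurve m n)
  have hra : (zywinaCurve m n).analyticRank = 2 := by
    have heq : (zywinaCurve m n).analyticRank = (zywinaCurve m n).mordellWeilRank := hBSD (zywinaCurve m n) ‹_›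
    rw [heq, mordellWeilRank_zywinaCurve h]
  refine ⟨hra, ?_, ?_, ?_⟩
  · have h0 := iteratedDeriv_entireLFunction_one_eq_zero (zywinaCurve m n) hL (k := 0) (by omega)
    simpa using h0
  · exact iteratedDeriv_entireLFunction_one_eq_zero (zywinaCurve m n) hL (k := 1) (by omega)
  · have hlead := iteratedDeriv_analyticRank_ne_zero (zywinaCurve m n) hL
    rwa [hra] at hlead

/-- **BSD ⟹ infinitely many `j`-invariants of analytic rank EXACTLY `2`** (modulo `zywinaSet_infinite` = Tao–Ziegler, Zywina §4):
distinct admissible pairs have distinct `j` (`Zywina2025.eq_of_j_eq`, Lemma 4.1).  Ladder row B1 records the conclusion as OPEN;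
this is the summit's cheapest infinite-family consequence at rank `2` typed in the kernel.  CONDITIONAL on `hBSD`, `hZ`.
[cite: Zywina2025, Thm 1.1, Lemma 4.1] -/
theorem infinite_setOf_j_analyticRank_two_of_bsd (hBSD : _root_.BirchSwinnertonDyer) (hZ : zywinaSet_infinite) :
    {j : ℚ | ∃ (W : WeierstrassCurve ℚ) (hW : W.IsElliptic),
      @WeierstrassCurve.j _ _ W hW = j ∧ W.analyticRank = 2 ∧ W.mordellWeilRank = 2}.Infinite := by
  classical
  let f : ℕ × ℕ → ℚ := fun p =>
    if hp : ZywinaAdmissible p.1 p.2 then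
      @WeierstrassCurve.j _ _ (zywinaCurve p.1 p.2) (isElliptic_zywinaCurve hp) else 0
  have hinj : Set.InjOn f zywinaSet := by
    rintro ⟨m₁, n₁⟩ h₁ ⟨m₂, n₂⟩ h₂ he
    have h₁' : ZywinaAdmissible m₁ n₁ := h₁
    have h₂' : ZywinaAdmissible m₂ n₂ := h₂
    simp only [f, dif_pos h₁', dif_pos h₂'] at he
    obtain ⟨rfl, rfl⟩ := eq_of_j_eq h₁' h₂' he
    rfl
  refine Set.infinite_of_injOn_mapsTo hinj ?_ hZ
  rintro ⟨m, n⟩ hp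
  have hp' : ZywinaAdmissible m n := hp
  have hr : (zywinaCurve m n).mordellWeilRank = 2 := mordellWeilRank_zywinaCurve hp'
  have hra : (zywinaCurve m n).analyticRank = 2 := by
    rw [hBSD (zywinaCurve m n) (isElliptic_zywinaCurve hp'), hr]
  exact ⟨zywinaCurve m n, isElliptic_zywinaCurve hp', by simp only [f, dif_pos hp'], hra, hr⟩

/-- **Family-wise (E2) ⟹ BSD-rank on infinitely many `j`-invariants of rank `2`** (modulo GZK, modularity, `zywinaSet_infinite`): if
`L″(E_{m,n},1) ≠ 0` for every admissible pair then the set of `j ∈ ℚ` carried by an elliptic `W/ℚ` with `ord_{s=1} L(W,s) = rank W(ℚ)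
= 2` is infinite — BSD-rank on an infinite rank-2 class, which would be summit-bearing (ladder §0).  CONDITIONAL on `hD` (open; per
member a certified-numerics statement), `hZ`. [cite: Zywina2025, Thm 1.1, Lemma 4.1] [cite: CremonaAlgorithms1997, §2.13 p. 37] -/
theorem infinite_setOf_j_bsdRank_two_of_secondDeriv (hmod : exists_isNewformOf)
    (hGZK : rank_eq_analyticRank_of_analyticRank_le_one) (hZ : zywinaSet_infinite)
    (hD : ∀ m n : ℕ, ZywinaAdmissible m n → iteratedDeriv 2 (zywinaCurve m n).entireLFunction 1 ≠ 0) :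
    {j : ℚ | ∃ (W : WeierstrassCurve ℚ) (hW : W.IsElliptic),
      @WeierstrassCurve.j _ _ W hW = j ∧ W.analyticRank = W.mordellWeilRank ∧ W.mordellWeilRank = 2}.Infinite := by
  classical
  let f : ℕ × ℕ → ℚ := fun p =>
    if hp : ZywinaAdmissible p.1 p.2 then
      @WeierstrassCurve.j _ _ (zywinaCurve p.1 p.2) (isElliptic_zywinaCurve hp) else 0
  have hinj : Set.InjOn f zywinaSet := by
    rintro ⟨m₁, n₁⟩ h₁ ⟨m₂, n₂⟩ h₂ he
    have h₁' : ZywinaAdmissible m₁ n₁ := h₁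
    have h₂' : ZywinaAdmissible m₂ n₂ := h₂
    simp only [f, dif_pos h₁', dif_pos h₂'] at he
    obtain ⟨rfl, rfl⟩ := eq_of_j_eq h₁' h₂' he
    rfl
  refine Set.infinite_of_injOn_mapsTo hinj ?_ hZ
  rintro ⟨m, n⟩ hp
  have hp' : ZywinaAdmissible m n := hp
  exact ⟨zywinaCurve m n, isElliptic_zywinaCurve hp', by simp only [f, dif_pos hp'],
    (zywina_bsdRank_iff_secondDeriv_ne_zero hmod hGZK hp').mpr (hD m n hp'), mordellWeilRank_zywinaCurve hp'⟩

end Class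

/-! ### §3. The odd-prime `p`-adic reading on the class -/

section PAdic

variable {m n : ℕ} (q : ℕ) [Fact q.Prime]

/-- **What `q`-adic BSD gives on `E_{m,n}` at an odd good ordinary prime `q`, and what it does not.**  Let `(m, n)` be admissible,
`q ≠ 2` good ordinary for (the global minimal model) `E_{m,n}`, `f` its newform at level `N`, `α_q` the unit root; grant Kato's
Thm. 18.4 at `q` (`hK`), GZK, modularity and `2`-parity.  Then: (i) `2 = rank ≤ corank_{ℤ_q} Sel_{q^∞}(E_{m,n}) = 2 + t_q ≤ ord_{T=0}
L_q(E_{m,n},T)` (the landed inequality chain, rank side a THEOREM); (ii) `ord_{T=0} L_q` and `r_an` are both EVEN (proved parity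
transfer + `w = +1`) and both `≥ 2`; (iii) `ord_{T=0} L_q = 2 ⟹ corank = 2 ∧ t_q = 0` (`Ш[q^∞]` finite; the cross-prime row); (iv) BSD-rank `⟺ r_an ≤ 2`.
The `q`-adic order does NOT cap `r_an`: (iii) with `r_an = 4` is the residual cell no theorem in print excludes
(`four_le_order_padicLFunction_or_residual`).  B1: windows and an equivalence; BSD not proved; no `ord_T L_q` is certified here.
[cite: Kato2004Asterisque, Thm. 18.4 (p. 281)] [cite: MazurTateTeitelbaum1986Invent, §I.17–I.18 and §II.10] [cite: Zywina2025, Thm 1.2] -/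
theorem zywina_padicWindow [(zywinaCurve m n).IsElliptic] [(zywinaCurve m n).IsGloballyMinimal]
    [NeZero ((zywinaCurve m n).conductorNorm ℤ)]
    (hmod : exists_isNewformOf) (hGZK : rank_eq_analyticRank_of_analyticRank_le_one)
    (hpar : ∀ (V : WeierstrassCurve ℚ) [V.IsElliptic], p_parity V 2) (h : ZywinaAdmissible m n) (hq : q ≠ 2)
    {f : CuspForm (Gamma0 ((zywinaCurve m n).conductorNorm ℤ)) 2} (hf : IsNewformOf (zywinaCurve m n) f)
    (hord : IsOrdinaryAt (zywinaCurve m n) q)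
    (hK : kato_selmerCorank_le_order_padicLFunction (zywinaCurve m n) q (f := f)) :
    (zywinaCurve m n).mordellWeilRank = 2 ∧
      (zywinaCurve m n).selmerCorank q = 2 + (zywinaCurve m n).shaCorank q ∧
      ((zywinaCurve m n).selmerCorank q : ℕ∞) ≤ (padicLFunction f (unitRoot (zywinaCurve m n) q : ℚ_[q])).order ∧
      (2 : ℕ∞) ≤ (padicLFunction f (unitRoot (zywinaCurve m n) q : ℚ_[q])).order ∧
      Even (padicLFunction f (unitRoot (zywinaCurve m n) q : ℚ_[q])).order.toNat ∧
      Even (zywinaCurve m n).analyticRank ∧ 2 ≤ (zywinaCurve m n).analyticRank ∧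
      ((padicLFunction f (unitRoot (zywinaCurve m n) q : ℚ_[q])).order = 2 →
        (zywinaCurve m n).selmerCorank q = 2 ∧ (zywinaCurve m n).shaCorank q = 0) ∧
      ((zywinaCurve m n).analyticRank = (zywinaCurve m n).mordellWeilRank ↔ (zywinaCurve m n).analyticRank ≤ 2) := by
  obtain ⟨hw, heven, h2, -⟩ := zywina_window hmod hGZK hpar h
  have hr : (zywinaCurve m n).mordellWeilRank = 2 := mordellWeilRank_zywinaCurve h
  have hsel : (zywinaCurve m n).selmerCorank q = 2 + (zywinaCurve m n).shaCorank q := by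
    rw [(zywinaCurve m n).selmerCorank_eq_mordellWeilRank_add_holds q, hr]
  have hKle : ((zywinaCurve m n).selmerCorank q : ℕ∞) ≤
      (padicLFunction f (unitRoot (zywinaCurve m n) q : ℚ_[q])).order := hK hq hord hf
  have h2le : (2 : ℕ∞) ≤ (padicLFunction f (unitRoot (zywinaCurve m n) q : ℚ_[q])).order := by
    have hc : (2 : ℕ∞) ≤ ((zywinaCurve m n).selmerCorank q : ℕ∞) := by
      have : 2 ≤ (zywinaCurve m n).selmerCorank q := by omega
      exact_mod_cast this
    exact hc.trans hKle
  have hpN : ¬ q ∣ (zywinaCurve m n).conductorNorm ℤ := not_dvd_level_of_isNewformOf hf hord.1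
  have hpt : Even (padicLFunction f (unitRoot (zywinaCurve m n) q : ℚ_[q])).order.toNat :=
    (even_order_padicLFunction_iff_even_analyticRank (zywinaCurve m n) q hf hpN hord).mpr heven
  refine ⟨hr, hsel, hKle, h2le, hpt, heven, h2, fun hord2 => ?_, zywina_bsdRank_iff_analyticRank_le_two hGZK h⟩
  have hc : (zywinaCurve m n).selmerCorank q ≤ 2 := by
    have hle := hKle
    rw [hord2] at hle
    exact_mod_cast hle
  exact ⟨by omega, by omega⟩

end PAdic

end Summit.BirchSwinnertonDyer.BirchSwinnertonDyer.Theorems.ShaPrimaryTransferZywinaBSDRankDoor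

end
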